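import Mathlib
import Literature.NumberTheory.LFunctions.KloostermanQuadraticTwist
import Literature.Analysis.Matrix.GramRowSumBound
import HarnessLib

/-!
# Kunisky–Yu `T^{4,4,1}`, step 3b: from the Gram row sums of `T⁽²⁾` to the mean-square bound — PROVED

Topic `Literature/Combinatorics/SimpleGraph` (support for `kuniskyYu2022_theorem_1_2`).
Kunisky–Yu (131)–(132): the matrix `T⁽¹⁾_{r,t} = K((rt/4)²) K(((1−r)t/4)²)` depends on `t` only
through `τ = (t/4)²`, so it is (a column-duplication of a column-submatrix of)
`T⁽²⁾_{r,τ} = K(r²τ) K((1−r)²τ)`: "`T⁽¹⁾` is a submatrix of `[1 1] ⊗ S` … thus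
`‖T⁽¹⁾‖ ≤ √2 ‖S‖ ≤ √2 ‖T⁽²⁾‖`".  As finite sums: with `w_τ = ∑_{(t/4)² = τ} z_t` one has
`∑_t z_t K((rt/4)²)K(((1−r)t/4)²) = ∑_τ T⁽²⁾_{r,τ} w_τ` and `∑_τ |w_τ|² ≤ 2 ∑_t |z_t|²` (fibres of
`t ↦ (t/4)²` have at most two elements), so a row-sum bound `R` for the Gram matrix
`T⁽²⁾ T⁽²⁾*` gives, by `Literature.Analysis.Matrix.sum_norm_sq_mulVec_le_of_gram_rowSum_le`,

  `∑_r |∑_t z_t K((rt/4)²) K(((1−r)t/4)²)|² ≤ 2R ∑_t |z_t|²`   (`paleyT1_meanSquare_le_of_gram_rowSum_le`).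

## References

* D. Kunisky, X. Yu, arXiv:2211.02713 (2022), proof of Theorem 4.20, (131)–(133).  [KuniskyYu2022]
-/

noncomputable section

open Finset
open Literature.NumberTheory.LFunctions
open Literature.Analysis.Matrix

namespace Literature.Combinatorics.SimpleGraph

section Squares

variable {p : ℕ} [hp : Fact p.Prime]

/-- Fibres of `t ↦ (t/4)²` have at most two elements (`p` odd). [folklore] -/
theorem card_filter_div_four_sq_eq_le_two (hp2 : p ≠ 2) (τ : ZMod p) :
    (Finset.univ.filter fun t : ZMod p => (t / 4) ^ 2 = τ).card ≤ 2 := by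
  classical
  have hF : ringChar (ZMod p) ≠ 2 := by rwa [ZMod.ringChar_zmod_n]
  have h2 : (2 : ZMod p) ≠ 0 := Ring.two_ne_zero hF
  have h4 : (4 : ZMod p) ≠ 0 := by
    have : (4 : ZMod p) = 2 * 2 := by norm_num
    rw [this]; exact mul_ne_zero h2 h2
  -- the fibre is the image of `{s : s² = τ}` under `s ↦ 4 s`
  have himg : (Finset.univ.filter fun t : ZMod p => (t / 4) ^ 2 = τ) =
      (Finset.univ.filter fun s : ZMod p => s ^ 2 = τ).image (fun s => 4 * s) := by
    ext t
    simp only [Finset.mem_filter, Finset.mem_univ, true_and, Finset.mem_image]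
    constructor
    · intro ht
      exact ⟨t / 4, ht, by field_simp⟩
    · rintro ⟨s, hs, rfl⟩
      rw [mul_div_cancel_left₀ s h4]
      exact hs
  rw [himg]
  refine (Finset.card_image_le).trans ?_
  have hc := quadraticChar_card_sqrts hF τ
  rw [Set.toFinset_setOf] at hc
  have hle : (quadraticChar (ZMod p) τ : ℤ) + 1 ≤ 2 := by
    rcases eq_or_ne τ 0 with h0 | h0
    · rw [h0, MulChar.map_zero]; norm_num
    · rcases quadraticChar_dichotomy h0 with h | h <;> rw [h] <;> norm_num
  have : ((Finset.univ.filter fun s : ZMod p => s ^ 2 = τ).card : ℤ) ≤ 2 := by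
    rw [hc]; exact hle
  exact_mod_cast this

/-- **The squares fibre costs a factor `2`** (Kunisky–Yu (132), "`‖T⁽¹⁾‖ ≤ ‖[1 1] ⊗ S‖ = √2 ‖S‖`"):
with `w_τ = ∑_{(t/4)² = τ} z_t`, `∑_τ |w_τ|² ≤ 2 ∑_t |z_t|²`. [cite: KuniskyYu2022, Theorem 4.20] -/
theorem sum_norm_sq_fibreSum_le (hp2 : p ≠ 2) (z : ZMod p → ℂ) :
    ∑ τ : ZMod p, ‖∑ t : ZMod p, (if (t / 4) ^ 2 = τ then z t else 0)‖ ^ 2 ≤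
      2 * ∑ t : ZMod p, ‖z t‖ ^ 2 := by
  classical
  have hCS : ∀ F : Finset (ZMod p), ‖∑ t ∈ F, z t‖ ^ 2 ≤ F.card * ∑ t ∈ F, ‖z t‖ ^ 2 := by
    intro F
    have h1 : ‖∑ t ∈ F, z t‖ ≤ ∑ t ∈ F, ‖z t‖ := norm_sum_le _ _
    have h2 : (∑ t ∈ F, ‖z t‖) ^ 2 ≤ F.card * ∑ t ∈ F, ‖z t‖ ^ 2 := sq_sum_le_card_mul_sum_sq
    calc ‖∑ t ∈ F, z t‖ ^ 2 ≤ (∑ t ∈ F, ‖z t‖) ^ 2 := by gcongr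
      _ ≤ _ := h2
  have hfil : ∀ τ : ZMod p, ∑ t : ZMod p, (if (t / 4) ^ 2 = τ then z t else 0) =
      ∑ t ∈ Finset.univ.filter (fun t : ZMod p => (t / 4) ^ 2 = τ), z t := by
    intro τ
    rw [Finset.sum_filter]
  simp_rw [hfil]
  calc ∑ τ : ZMod p, ‖∑ t ∈ Finset.univ.filter (fun t : ZMod p => (t / 4) ^ 2 = τ), z t‖ ^ 2
      ≤ ∑ τ : ZMod p, (2 : ℝ) *
          ∑ t ∈ Finset.univ.filter (fun t : ZMod p => (t / 4) ^ 2 = τ), ‖z t‖ ^ 2 := by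
        refine Finset.sum_le_sum fun τ _ => ?_
        refine (hCS _).trans ?_
        refine mul_le_mul_of_nonneg_right ?_ (Finset.sum_nonneg fun t _ => by positivity)
        exact_mod_cast card_filter_div_four_sq_eq_le_two hp2 τ
    _ = 2 * ∑ t : ZMod p, ‖z t‖ ^ 2 := by
        rw [← Finset.mul_sum]
        congr 1
        exact Finset.sum_fiberwise Finset.univ (fun t : ZMod p => (t / 4) ^ 2) fun t => ‖z t‖ ^ 2

/-- Regrouping by the value of `(t/4)²`:
`∑_t z_t K((rt/4)²) K(((1−r)t/4)²) = ∑_τ K(r²τ) K((1−r)²τ) w_τ`. [cite: KuniskyYu2022, Theorem 4.20 (131)] -/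
theorem paleyT1_apply_eq_T2_fibreSum (r : ZMod p) (z : ZMod p → ℂ) :
    ∑ t : ZMod p, z t * kloostermanSum p 1 ((r * t / 4) ^ 2) *
        kloostermanSum p 1 (((1 - r) * t / 4) ^ 2) =
      ∑ τ : ZMod p, kloostermanSum p 1 (r ^ 2 * τ) * kloostermanSum p 1 ((1 - r) ^ 2 * τ) *
        ∑ t : ZMod p, (if (t / 4) ^ 2 = τ then z t else 0) := by
  classical
  have hkey : ∀ t : ZMod p, z t * kloostermanSum p 1 ((r * t / 4) ^ 2) *
      kloostermanSum p 1 (((1 - r) * t / 4) ^ 2) =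
      ∑ τ : ZMod p, kloostermanSum p 1 (r ^ 2 * τ) * kloostermanSum p 1 ((1 - r) ^ 2 * τ) *
        (if (t / 4) ^ 2 = τ then z t else 0) := by
    intro t
    simp_rw [mul_ite, mul_zero]
    rw [Finset.sum_ite_eq Finset.univ ((t / 4) ^ 2)]
    simp only [Finset.mem_univ, if_true]
    have e1 : (r * t / 4) ^ 2 = r ^ 2 * (t / 4) ^ 2 := by ring
    have e2 : ((1 - r) * t / 4) ^ 2 = (1 - r) ^ 2 * (t / 4) ^ 2 := by ring
    rw [e1, e2]
    ring
  simp_rw [hkey]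
  rw [Finset.sum_comm]
  refine Finset.sum_congr rfl fun τ _ => ?_
  rw [Finset.mul_sum]

/-- **Mean-square bound from the Gram row sums of `T⁽²⁾`** (Kunisky–Yu (132)–(133)): if every
absolute row sum of `T⁽²⁾T⁽²⁾*`, `T⁽²⁾_{r,τ} = K(r²τ)K((1−r)²τ)`, is at most `R ≥ 0`, then
`∑_r |∑_t z_t K((rt/4)²) K(((1−r)t/4)²)|² ≤ 2R ∑_t |z_t|²`. [cite: KuniskyYu2022, Theorem 4.20] -/
theorem paleyT1_meanSquare_le_of_gram_rowSum_le (hp2 : p ≠ 2) {R : ℝ} (hR0 : 0 ≤ R)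
    (hR : ∀ r : ZMod p, ∑ r' : ZMod p,
      ‖∑ τ : ZMod p, (kloostermanSum p 1 (r ^ 2 * τ) * kloostermanSum p 1 ((1 - r) ^ 2 * τ)) *
        (starRingEnd ℂ) (kloostermanSum p 1 (r' ^ 2 * τ) *
          kloostermanSum p 1 ((1 - r') ^ 2 * τ))‖ ≤ R)
    (z : ZMod p → ℂ) :
    ∑ r : ZMod p, ‖∑ t : ZMod p, z t * kloostermanSum p 1 ((r * t / 4) ^ 2) *
        kloostermanSum p 1 (((1 - r) * t / 4) ^ 2)‖ ^ 2 ≤ (2 * R) * ∑ t : ZMod p, ‖z t‖ ^ 2 := by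
  classical
  set w : ZMod p → ℂ := fun τ => ∑ t : ZMod p, (if (t / 4) ^ 2 = τ then z t else 0) with hw
  simp_rw [paleyT1_apply_eq_T2_fibreSum]
  have hG := sum_norm_sq_mulVec_le_of_gram_rowSum_le
    (fun r τ : ZMod p => kloostermanSum p 1 (r ^ 2 * τ) * kloostermanSum p 1 ((1 - r) ^ 2 * τ))
    hR0 hR w
  refine hG.trans ?_
  have h2 := sum_norm_sq_fibreSum_le hp2 z
  calc R * ∑ τ : ZMod p, ‖w τ‖ ^ 2 ≤ R * (2 * ∑ t : ZMod p, ‖z t‖ ^ 2) :=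
        mul_le_mul_of_nonneg_left h2 hR0
    _ = (2 * R) * ∑ t : ZMod p, ‖z t‖ ^ 2 := by ring

end Squares

end Literature.Combinatorics.SimpleGraph

end
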